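import Summits.BirchSwinnertonDyer.BirchSwinnertonDyer.Theorems.PrintCf2SplitBadTwoRestrictedSelmerH2Vanishing
import Summits.BirchSwinnertonDyer.BirchSwinnertonDyer.Theorems.PrintCf2SplitBadTwoRestrictedSelmerDualModuleFinite
import Summits.BirchSwinnertonDyer.Rank1Residual.X11b.AnticyclotomicCoinvariants
import HarnessLib

/-!
# Crux `PrintCf2.SplitBadTwoRankOneOfFacts` (stmt-BirchSwinnertonDyer-20368), road α v10.3, S3c residual (R-TOP) = brick B17, input (β):
# THE BASE LIFT for `𝔖_{v̄}(K*_∞, W*)` ⟸ a TOWER-FREE, LEVEL-`K` local surjectivity (LS) — JSW17 Lemma 3.3.3 second half for Agboola's module,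
# steps (2) (3) (5) in the kernel; step (4) (Poitou–Tate surgery) displayed

Cell `bsd-print-cf2`, EXTRA WIDTH seat `bsd-line-cf2-p1-w4` g9 (prover-bsd-line-cf2-p1-w4-g9-0); `--supports stmt-BirchSwinnertonDyer-20368`
(helper, Theses-free). HONEST FRAMING: nothing here closes the crux or a registered stub; BSD is not proved by any of this; no summit statement
is proved by this seat. No definition, no named fact, no `sorry`. CONDITIONAL (§3–§4) on the displayed hypothesis (LS) below and, in §4, on the cited
facts `poitouTate_sha_tateDual K`, `fieldCdLE_two_of_numberField` (through file 2, p667090).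

WHAT. File 2 (p667090) left (R-TOP) of LEAD g12's p664178 as «(β) base lift + hfinB' + facts». (β) says: every class `c ∈ H¹(K*_∞, W*)` whose
`Γ`-coboundary `conj_γ c − c` lies in `𝔖 = 𝔖_{v̄}(K*_∞, W*)` is congruent mod `𝔖` to a class restricted from `H¹(K, W*)`. THIS FILE proves (β) from
 (LS) «for every finite set `S` of finite places away from `p` or equal to `𝔮 = v̄`, and every family `τ_w ∈ H¹(D_w, W*)`, `w ∈ S`, there is a
      global `g ∈ H¹(Γ_K, W*)` with `res_{D_w} g = τ_w` on `S` and `res_{D_w} g = 0` at every finite `w ∉ S` away from `p`»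
— the level-`K`, tower-free Poitou–Tate surjectivity whose dual obstruction is `H¹_{str v}(K, T_v W)` (the SAME group as the surjectivity defect
`δ` of LEAD g12's memo `S3C-DEFECT-VANISHES-g12.md` §2 for (R-LEVELK)); TRUE at analytic rank one (loc_v injective on `H¹(K, T_v W) ≅ ℤ₂·κ(P) ⊕ W[v](K)`),
to be discharged by the port of X11b's `LevelLiftingWithP` chain to `W*`-families (next file of this lane). Mechanism = X11b
`Coinv.coinvariantsTrivialAt_of_subsingleton` steps (2) (3) (5) for the CM summand:
 (2) `conjH1_sub_mem_restrictedSelmerZp_of_isTopGenerator` — all conjugates of `c` agree with `c` mod `𝔖` (generic: open stabiliser of a class,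
     `GreenbergSelmer.exists_openNormalSubgroup_conjH1_eq`, + `Γ_K = Gal(K̄/K_a)·γ^ℕ`);
 (3) `exists_resSubgroup_kerD_eq_of_forall` — local lifts `z_w ∈ H¹(D_w, W*)` at every `w ∤ p` and at `𝔮` (procyclic descent on `D_w`,
     `X11b.ProcyclicDescent.exists_resSubgroup_eq_of_forall_conjH1_eq`); `resKerD_eq_zero_of_good` — at good `w ∤ p` where the cocycle of `c` is
     unramified the class is ALREADY locally trivial (pushed into `E[p^∞]` by the summand inclusion `ι_*`, X11b `Coinv.eq_zero_of_inertia_le`, and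
     `ι_*` is injective on `H¹(ker κ ∩ D_w, ·)` by -w7 g2's projector retraction), so `S` := the finite exceptional set `∪ {𝔮}`;
 (5) `baseLift_of_locSurj` — `y = c − res g ∈ 𝔖`.
 §4 `natCard_endCoinvariants_eq_one_of_frame_of_locSurj`: (R-TOP) of p664178 on every S3c frame ⟸ (LS) + hfinB' + the two facts.
presearch: JSW17 Lemma 3.3.3 + Prop. 3.3.2 (arXiv:1512.06894 pp. 11–12); Greenberg LNM 1716 §4 pp. 122–125 (remark after Prop. 4.13); held, no new
fact. beyond-print theorem: no.

References: [JetchevSkinnerWan2017] Lemma 3.3.3, Prop. 3.3.2; [GreenbergLNM1716] §4 Props. 4.13–4.15; [Agboola2007] §5 Prop. 5.1;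
[SerreGaloisCohomology1997] I §2.4–2.6; [Castella2018] Def. 2.2, Thm. 2.3.
-/

noncomputable section

open scoped Classical

set_option linter.dupNamespace false
set_option autoImplicit false

open CategoryTheory NumberField IsDedekindDomain Field WeierstrassCurve
open Literature.NumberTheory.EllipticCurves Literature.NumberTheory.EllipticCurves.GreenbergSelmer
open Literature.NumberTheory.EllipticCurves.Agboola2007
open Literature.NumberTheory.EllipticCurves.IwasawaAlgebra
open Literature.NumberTheory.EllipticCurves.IwasawaDual
open Literature.NumberTheory.GaloisRepresentations
open Literature.NumberTheory.GaloisCohomology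
open Summit.BirchSwinnertonDyer.Rank1Residual.X11b
open Summit.BirchSwinnertonDyer.BirchSwinnertonDyer.Theorems.PrintCf2.AdditiveAtSeven

namespace Summit.BirchSwinnertonDyer.BirchSwinnertonDyer.Theorems.PrintCf2.RestrictedSelmerPair

/-! ## §1. Generic: all conjugates, local conditions as `resKerD = 0`, local lifts -/

section Generic

variable {K : Type} [Field K] [NumberField K] {p : ℕ} [Fact p.Prime] (κ : ZpExtension K p)
  (M : Type) [AddCommGroup M] [DistribMulAction (absoluteGaloisGroup K) M] [TopologicalSpace M]
  [DiscreteTopology M] (𝔮 : HeightOneSpectrum (𝓞 K))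

/-- **Every class of `H¹(K_∞, M)` is fixed by `Gal(K̄/K_a) = κ⁻¹(p^a ℤ_p)` for some `a`** (`M` with open stabilisers): the stabiliser of the
class contains an open normal subgroup (`GreenbergSelmer.exists_openNormalSubgroup_conjH1_eq`) and `ker κ`; index bookkeeping as in the tree's
`E[p^∞]` version `exists_forall_mem_layerSubgroup_conjH1_eq` (ported verbatim). [cite: SerreGaloisCohomology1997, I §2.6 (b)]
[cite: GreenbergLNM1716, §1 (after Conj. 1.3)] -/
theorem exists_forall_mem_layerSubgroup_conjH1_eq_of_isOpen
    (hstab : ∀ m : M, IsOpen (MulAction.stabilizer (absoluteGaloisGroup K) m : Set (absoluteGaloisGroup K)))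
    (c : subgroupH1 κ.kerSubgroup M) :
    ∃ a : ℕ, ∀ τ ∈ κ.layerSubgroup a, conjH1 κ.kerSubgroup M τ c = c := by
  obtain ⟨Nrm, hNrm⟩ := GreenbergSelmer.exists_openNormalSubgroup_conjH1_eq κ M hstab c
  haveI : Finite (absoluteGaloisGroup K ⧸ Nrm.toSubgroup) := Subgroup.quotient_finite_of_isOpen _ Nrm.isOpen
  have hd : Nrm.toSubgroup.index ≠ 0 := Subgroup.index_ne_zero_of_finite
  obtain ⟨a, e, he, hde⟩ := Nat.exists_eq_pow_mul_and_not_dvd hd p (Fact.out : p.Prime).ne_one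
  obtain ⟨u, hu⟩ := IwasawaDual.isUnit_natCast_padicInt (p := p) he
  refine ⟨a, fun τ hτ ↦ ?_⟩
  rw [ZpExtension.mem_layerSubgroup] at hτ
  obtain ⟨y, hy⟩ := hτ
  obtain ⟨g₀, hg₀⟩ := κ.surjective (Multiplicative.ofAdd (((u⁻¹ : ℤ_[p]ˣ) : ℤ_[p]) * y))
  have hg₀' : κ g₀ = Multiplicative.ofAdd (((u⁻¹ : ℤ_[p]ˣ) : ℤ_[p]) * y) := hg₀
  have hτN : g₀ ^ Nrm.toSubgroup.index ∈ Nrm := Nrm.toSubgroup.pow_index_mem g₀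
  have hκτ : (κ (g₀ ^ Nrm.toSubgroup.index)).toAdd = (p : ℤ_[p]) ^ a * y := by
    rw [map_pow, hg₀', ← ofAdd_nsmul, toAdd_ofAdd, nsmul_eq_mul, hde, Nat.cast_mul, Nat.cast_pow, ← hu, mul_assoc,
      ← mul_assoc (u : ℤ_[p]), Units.mul_inv, one_mul]
  have hh₀ : (g₀ ^ Nrm.toSubgroup.index)⁻¹ * τ ∈ κ.kerSubgroup := by
    rw [ZpExtension.mem_kerSubgroup, map_mul, map_inv]
    apply Multiplicative.toAdd.injective
    rw [toAdd_mul, toAdd_inv, hκτ, hy, toAdd_one, neg_add_cancel]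
  conv_lhs => rw [← mul_inv_cancel_left (g₀ ^ Nrm.toSubgroup.index) τ]
  rw [Literature.NumberTheory.EllipticCurves.conjH1_mul_holds κ.kerSubgroup M, AddMonoidHom.comp_apply,
    Literature.NumberTheory.EllipticCurves.conjH1_of_mem_holds κ.kerSubgroup M hh₀, AddMonoidHom.id_apply]
  exact hNrm _ hτN

/-- **All conjugates of `c` agree with `c` modulo `𝔖_𝔮(K_∞, M)` when `conj_γ c − c ∈ 𝔖_𝔮(K_∞, M)` for a topological generator `γ`**:
powers of `γ` by induction (`𝔖` is `Γ_K`-stable), a layer subgroup fixes `c` (previous lemma), and `Γ_K = Gal(K̄/K_a)·γ^ℕ`. JSW17's step (2),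
generic. [cite: JetchevSkinnerWan2017, Lemma 3.3.3 (arXiv:1512.06894 p. 12)] [cite: SerreGaloisCohomology1997, I §2.6 (b)] -/
theorem conjH1_sub_mem_restrictedSelmerZp_of_isTopGenerator
    (hstab : ∀ m : M, IsOpen (MulAction.stabilizer (absoluteGaloisGroup K) m : Set (absoluteGaloisGroup K)))
    {γ : absoluteGaloisGroup K} (hγ : κ.IsTopGenerator γ) {c : subgroupH1 κ.kerSubgroup M}
    (hc : conjH1 κ.kerSubgroup M γ c - c ∈ restrictedSelmerZp κ M 𝔮) (g : absoluteGaloisGroup K) :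
    conjH1 κ.kerSubgroup M g c - c ∈ restrictedSelmerZp κ M 𝔮 := by
  have hpow : ∀ k : ℕ, conjH1 κ.kerSubgroup M (γ ^ k) c - c ∈ restrictedSelmerZp κ M 𝔮 := by
    intro k
    induction k with
    | zero =>
      rw [pow_zero, Literature.NumberTheory.EllipticCurves.conjH1_one_holds κ.kerSubgroup M, AddMonoidHom.id_apply, sub_self]
      exact zero_mem _
    | succ k ih =>
      have e : conjH1 κ.kerSubgroup M (γ ^ (k + 1)) c - c =
          conjH1 κ.kerSubgroup M γ (conjH1 κ.kerSubgroup M (γ ^ k) c - c) + (conjH1 κ.kerSubgroup M γ c - c) := by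
        rw [pow_succ', Literature.NumberTheory.EllipticCurves.conjH1_mul_holds κ.kerSubgroup M, AddMonoidHom.comp_apply, map_sub]
        abel
      rw [e]
      exact add_mem (conjH1_mem_restrictedSelmerZp κ M 𝔮 γ ih) hc
  obtain ⟨a, ha⟩ := exists_forall_mem_layerSubgroup_conjH1_eq_of_isOpen κ M hstab c
  obtain ⟨h, hh, k, rfl⟩ := Coinv.exists_mem_layerSubgroup_mul_pow p κ hγ a g
  have e : conjH1 κ.kerSubgroup M (h * γ ^ k) c - c = conjH1 κ.kerSubgroup M h (conjH1 κ.kerSubgroup M (γ ^ k) c - c) := by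
    rw [Literature.NumberTheory.EllipticCurves.conjH1_mul_holds κ.kerSubgroup M, AddMonoidHom.comp_apply, map_sub, ha h hh]
  rw [e]
  exact conjH1_mem_restrictedSelmerZp κ M 𝔮 h (hpow k)

variable {κ M 𝔮} in
/-- A class of `𝔖_𝔮(K_∞, M)` dies under `resKerD` at every finite `w ∤ p` and at `𝔮` (the away / strict conditions; X11b's
`resKerD_eq_zero_of_mem_selmerAc` for Agboola's group — the two `selmerOver`s agree definitionally). [cite: Agboola2007, §3 (arXiv p0008:L58–64)]
[cite: Castella2018, Def. 2.2] -/
theorem resKerD_eq_zero_of_mem_restrictedSelmerZp {w : HeightOneSpectrum (𝓞 K)} (hw : ((p : ℕ) : 𝓞 K) ∉ w.asIdeal ∨ w = 𝔮)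
    {s : subgroupH1 κ.kerSubgroup M} (hs : s ∈ restrictedSelmerZp κ M 𝔮) : Coinv.resKerD κ M w s = 0 := by
  rw [← Coinv.mem_awayKer_iff_resKerD_eq_zero]
  have hs' : s ∈ Summit.BirchSwinnertonDyer.Rank1Residual.X11b.AcSelmer.selmerOver κ.kerSubgroup M p 𝔮 ∅ := hs
  rcases hw with hpw | rfl
  · have h := ((Summit.BirchSwinnertonDyer.Rank1Residual.X11b.AcSelmer.mem_selmerOver_iff_awayKer _ _ s).1 hs').1 w hpw
      (Set.notMem_empty w) 1
    rwa [Literature.NumberTheory.EllipticCurves.conjH1_one_holds, AddMonoidHom.id_apply] at h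
  · have h := ((Summit.BirchSwinnertonDyer.Rank1Residual.X11b.AcSelmer.mem_selmerOver_iff_awayKer _ _ s).1 hs').2.2 1
    rwa [Literature.NumberTheory.EllipticCurves.conjH1_one_holds, AddMonoidHom.id_apply] at h

variable {κ M 𝔮} in
/-- **The local lift (JSW17: "`H¹(K_w, W) → H¹(K_w, M)^Γ` is surjective")** at a finite `w ∤ p` or `w = 𝔮`, for a class all of whose conjugates
agree with it modulo `𝔖_𝔮(K_∞, M)`: `res_{ker κ ∩ D_w} c` is `D_w`-invariant, hence restricted from `H¹(D_w, M)` (procyclic descent on `D_w`).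
X11b's `Coinv.exists_resSubgroup_kerD_eq` for a general `p`-primary `M` with open stabilisers. [cite: JetchevSkinnerWan2017, Lemma 3.3.3 (arXiv:1512.06894 p. 12)]
[cite: SerreGaloisCohomology1997, I §2.6 (b)] -/
theorem exists_resSubgroup_kerD_eq_of_forall (hstab : ∀ m : M, IsOpen {σ : absoluteGaloisGroup K | σ • m = m})
    (htor : ∀ m : M, ∃ k : ℕ, p ^ k • m = 0) (w : HeightOneSpectrum (𝓞 K)) (hw : ((p : ℕ) : 𝓞 K) ∉ w.asIdeal ∨ w = 𝔮)
    {c : subgroupH1 κ.kerSubgroup M} (hSel : ∀ g : absoluteGaloisGroup K, conjH1 κ.kerSubgroup M g c - c ∈ restrictedSelmerZp κ M 𝔮) :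
    ∃ z : subgroupH1 (decomp (K := K) w) M, ResKernel.resSubgroup (Coinv.kerD κ w) M z = Coinv.resKerD κ M w c := by
  haveI : CompactSpace (absoluteGaloisGroup K) := absoluteGaloisGroup_compactSpace K
  haveI : CompactSpace (decomp (K := K) w) := isCompact_iff_compactSpace.mp (Coinv.isClosed_decomp w).isCompact
  have hA : ∀ a : M, IsOpen {d : decomp (K := K) w | d • a = a} := fun a ↦ (hstab a).preimage continuous_subtype_val
  refine ProcyclicDescent.exists_resSubgroup_eq_of_forall_conjH1_eq hA (Coinv.kappaD κ w) htor (Coinv.resKerD κ M w c) fun d ↦ ?_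
  have e : conjH1 κ.kerSubgroup M (d : absoluteGaloisGroup K) c = c + (conjH1 κ.kerSubgroup M (d : absoluteGaloisGroup K) c - c) := by
    abel
  rw [← Coinv.resKerD_conjH1, e, map_add, resKerD_eq_zero_of_mem_restrictedSelmerZp hw (hSel _), add_zero]

end Generic

/-! ## §2. The CM summand: local triviality at the good unramified places, via `ι_*` into `E[p^∞]` -/

section Summand

variable {K : Type} [Field K] [NumberField K] (V : WeierstrassCurve K) [V.IsElliptic] (p : ℕ) [Fact p.Prime]
  (π : V.endRing) (r : ℤ_[p]) (κ : ZpExtension K p) (𝔮 : HeightOneSpectrum (𝓞 K))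

/-- **At a good `w ∤ p` where the cocycle of `c ∈ H¹(K_∞, E[𝔮^∞])` vanishes on inertia, `c` is locally trivial at the chosen place above `w`**
(`resKerD c = 0`), for a class all of whose conjugates agree with it mod `𝔖`: push into `E[p^∞]` by `ι_*` (p663006 naturality with `conj` and with
the Selmer conditions), apply X11b's `Coinv.eq_zero_of_inertia_le` (`H¹(D_w, E[p^∞]) ↪ H¹(I_w, E[p^∞])` at good `w`), and pull back: `ι_*` is
injective on `H¹(ker κ ∩ D_w, ·)` (retraction by an equivariant projector `e`, -w7 g2). [cite: GreenbergLNM1716, §3 Lemma 3.3 (p. 87)]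
[cite: SerreGaloisCohomology1997, I §2.4] -/
theorem resKerD_eq_zero_of_good (e : V.geomPrimaryTorsion p →+ ↥(V.endEigenPrimaryTorsion p π r))
    (he₁ : ∀ x : ↥(V.endEigenPrimaryTorsion p π r), e x = x)
    (he : ∀ (σ : absoluteGaloisGroup K) (x : V.geomPrimaryTorsion p), e (σ • x) = σ • e x)
    {w : HeightOneSpectrum (𝓞 K)} (hpw : ((p : ℕ) : 𝓞 K) ∉ w.asIdeal) (hgood : V.HasGoodReductionAt w)
    (φ : contOneCocycles (discreteTopRep κ.kerSubgroup ↥(V.endEigenPrimaryTorsion p π r)))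
    {N₁ : Subgroup (absoluteGaloisGroup K)}
    (hN₁ : ∀ (h : absoluteGaloisGroup K) (hh : h ∈ κ.kerSubgroup), h ∈ N₁ → φ.1 ⟨h, hh⟩ = 0)
    (hI : (adicCompletionPrime K w).inertia (absoluteGaloisGroup K) ≤ N₁)
    (hSel : ∀ g : absoluteGaloisGroup K,
      conjH1 κ.kerSubgroup ↥(V.endEigenPrimaryTorsion p π r) g (oneCocycleClass _ φ) - oneCocycleClass _ φ ∈
        restrictedSelmerZp κ ↥(V.endEigenPrimaryTorsion p π r) 𝔮) :
    Coinv.resKerD κ ↥(V.endEigenPrimaryTorsion p π r) w (oneCocycleClass _ φ) = 0 := by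
  set ιK := resH1Hom (ContinuousMonoidHom.id κ.kerSubgroup) (V.endEigenPrimaryTorsion p π r).subtype
    (subtype_smul_endEigenPrimaryTorsion V p π r κ.kerSubgroup) with hιK
  -- the pushed cocycle `ι ∘ φ`
  set φ' := contOneCocycles.pullback (ContinuousMonoidHom.id κ.kerSubgroup)
    (resHomOfEquivariant (ContinuousMonoidHom.id κ.kerSubgroup) (V.endEigenPrimaryTorsion p π r).subtype
      (subtype_smul_endEigenPrimaryTorsion V p π r κ.kerSubgroup)) φ with hφ'
  have hιφ : ιK (oneCocycleClass _ φ) = oneCocycleClass _ φ' := resH1Hom_oneCocycleClass _ _ _ φ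
  have hN₁' : ∀ (h : absoluteGaloisGroup K) (hh : h ∈ κ.kerSubgroup), h ∈ N₁ → φ'.1 ⟨h, hh⟩ = 0 := fun h hh hN ↦ by
    change (V.endEigenPrimaryTorsion p π r).subtype (φ.1 ⟨h, hh⟩) = 0
    rw [hN₁ h hh hN, map_zero]
  have hSel' : ∀ g : absoluteGaloisGroup K,
      V.conjH1 p κ.kerSubgroup g (oneCocycleClass _ φ') - oneCocycleClass _ φ' ∈ AcSelmer.selmerAc V p κ 𝔮 ∅ := fun g ↦ by
    change conjH1 κ.kerSubgroup (V.geomPrimaryTorsion p) g (oneCocycleClass _ φ') - oneCocycleClass _ φ' ∈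
      restrictedSelmerZp κ (V.geomPrimaryTorsion p) 𝔮
    rw [← hιφ, ← AddMonoidHom.comp_apply, conjH1_comp_toPrimaryH1, AddMonoidHom.comp_apply, ← map_sub]
    exact toPrimaryH1_mem_restrictedSelmer V p π r κ 𝔮 (hSel g)
  obtain ⟨z, hz⟩ := Coinv.exists_resSubgroup_kerD_eq (W := V) (p := p) (κ := κ) w (Or.inl ⟨hpw, Set.notMem_empty w⟩) hSel'
  have h0 := (Coinv.eq_zero_of_inertia_le (W := V) (p := p) (κ := κ) hpw hgood φ' hN₁' hI z hz).2
  rw [← hιφ] at h0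
  -- naturality `resKerD ∘ ι_* = ι_* ∘ resKerD` and injectivity of `ι_*` on `H¹(ker κ ∩ D_w, ·)`
  set ιD := resH1Hom (ContinuousMonoidHom.id (Coinv.kerD κ w)) (V.endEigenPrimaryTorsion p π r).subtype
    (N := V.geomPrimaryTorsion p) (fun _ _ ↦ rfl) with hιD
  have hnat : (Coinv.resKerD κ (V.geomPrimaryTorsion p) w).comp ιK =
      ιD.comp (Coinv.resKerD κ ↥(V.endEigenPrimaryTorsion p π r) w) := by
    rw [Coinv.resKerD, Coinv.resKerD, hιK, hιD, resH1Hom_comp, resH1Hom_comp]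
    exact resH1Hom_congr (by ext; rfl) (by ext; rfl) _ _
  have h1 : ιD (Coinv.resKerD κ ↥(V.endEigenPrimaryTorsion p π r) w (oneCocycleClass _ φ)) = 0 := by
    rw [← AddMonoidHom.comp_apply, ← hnat, AddMonoidHom.comp_apply]
    exact h0
  have hret : (resH1Hom (ContinuousMonoidHom.id (Coinv.kerD κ w)) e (N := ↥(V.endEigenPrimaryTorsion p π r))
      (fun σ x ↦ he ((σ : decomp (K := K) w) : absoluteGaloisGroup K) x)).comp ιD = AddMonoidHom.id _ := by
    rw [hιD, resH1Hom_comp]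
    have hcomp : e.comp (V.endEigenPrimaryTorsion p π r).subtype = AddMonoidHom.id _ := AddMonoidHom.ext fun x ↦ he₁ x
    have hφc : (ContinuousMonoidHom.id (Coinv.kerD κ w)).comp (ContinuousMonoidHom.id _) = ContinuousMonoidHom.id _ :=
      ContinuousMonoidHom.ext fun _ ↦ rfl
    rw [resH1Hom_congr hφc hcomp _ (fun _ _ ↦ rfl), resH1Hom_id]
  have h2 := congrArg (fun f ↦ f (Coinv.resKerD κ ↥(V.endEigenPrimaryTorsion p π r) w (oneCocycleClass _ φ))) hret
  simp only [AddMonoidHom.comp_apply, AddMonoidHom.id_apply, h1, map_zero] at h2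
  exact h2.symm

/-- **(β) THE BASE LIFT ⟸ (LS)** for the CM summand `M = E[𝔮_r^∞]` of an elliptic `V` over a totally complex `K` (`𝔮 ∣ p` the strict place, `κ`
any `ℤ_p`-extension with topological generator `γ`, `e` an equivariant projector onto the summand): every `c ∈ H¹(K_∞, M)` with `conj_γ c − c ∈
𝔖_𝔮(K_∞, M)` is congruent modulo `𝔖_𝔮(K_∞, M)` to a class restricted from `K`, GRANTED (LS): finitely supported families of local classes away
from `p` or at `𝔮` are hit EXACTLY by `loc` on `H¹(Γ_K, M)`, with zero components at the other places away from `p`. JSW17 Lemma 3.3.3 steps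
(2)(3)(5); step (4) = (LS). [cite: JetchevSkinnerWan2017, Lemma 3.3.3 and Prop. 3.3.2 (arXiv:1512.06894 pp. 11–12)] [cite: GreenbergLNM1716, §4 pp. 122–125] -/
theorem baseLift_of_locSurj [IsTotallyComplex K] (h𝔮 : ((p : ℕ) : 𝓞 K) ∈ 𝔮.asIdeal)
    (e : V.geomPrimaryTorsion p →+ ↥(V.endEigenPrimaryTorsion p π r))
    (he₁ : ∀ x : ↥(V.endEigenPrimaryTorsion p π r), e x = x)
    (he : ∀ (σ : absoluteGaloisGroup K) (x : V.geomPrimaryTorsion p), e (σ • x) = σ • e x)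
    {γ : absoluteGaloisGroup K} (hγ : κ.IsTopGenerator γ)
    (hLS : ∀ (S : Finset (HeightOneSpectrum (𝓞 K))), (∀ w ∈ S, ((p : ℕ) : 𝓞 K) ∉ w.asIdeal ∨ w = 𝔮) →
      ∀ τ : (w : HeightOneSpectrum (𝓞 K)) → subgroupH1 (decomp (K := K) w) ↥(V.endEigenPrimaryTorsion p π r),
      ∃ g : discreteH1 (absoluteGaloisGroup K) ↥(V.endEigenPrimaryTorsion p π r),
        (∀ w ∈ S, ResKernel.resSubgroup (decomp (K := K) w) ↥(V.endEigenPrimaryTorsion p π r) g = τ w) ∧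
        (∀ w : HeightOneSpectrum (𝓞 K), w ∉ S → ((p : ℕ) : 𝓞 K) ∉ w.asIdeal →
          ResKernel.resSubgroup (decomp (K := K) w) ↥(V.endEigenPrimaryTorsion p π r) g = 0)) :
    ∀ c : subgroupH1 κ.kerSubgroup ↥(V.endEigenPrimaryTorsion p π r),
      conjH1 κ.kerSubgroup ↥(V.endEigenPrimaryTorsion p π r) γ c - c ∈ restrictedSelmerZp κ ↥(V.endEigenPrimaryTorsion p π r) 𝔮 →
        ∃ z : subgroupH1 (⊤ : Subgroup (absoluteGaloisGroup K)) ↥(V.endEigenPrimaryTorsion p π r),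
          c - resOfLe ↥(V.endEigenPrimaryTorsion p π r) (le_top : κ.kerSubgroup ≤ ⊤) z ∈
            restrictedSelmerZp κ ↥(V.endEigenPrimaryTorsion p π r) 𝔮 := by
  intro c hc
  set M := ↥(V.endEigenPrimaryTorsion p π r) with hM
  have hstab : ∀ m : M, IsOpen (MulAction.stabilizer (absoluteGaloisGroup K) m : Set (absoluteGaloisGroup K)) :=
    fun m ↦ isOpen_stabilizer_endEigenPrimaryTorsion V p π r m
  have hstab' : ∀ m : M, IsOpen {σ : absoluteGaloisGroup K | σ • m = m} :=
    fun m ↦ isOpen_stabilizer_endEigenPrimaryTorsion V p π r m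
  have htor : ∀ m : M, ∃ k : ℕ, p ^ k • m = 0 := exists_pow_smul_endEigenPrimaryTorsion_eq_zero V p π r
  -- (2) all conjugates of `c` agree with `c` modulo `𝔖`
  have hSel : ∀ g : absoluteGaloisGroup K, conjH1 κ.kerSubgroup M g c - c ∈ restrictedSelmerZp κ M 𝔮 :=
    conjH1_sub_mem_restrictedSelmerZp_of_isTopGenerator κ M 𝔮 hstab hγ hc
  -- the cocycle of `c` and its zero set; the finite exceptional set
  obtain ⟨φ, hφ⟩ := oneCocycleClass_surjective _ c
  obtain ⟨N₁, hN₁⟩ := Coinv.exists_openNormalSubgroup_forall_apply_eq_zero (K := K) φ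
  set S' : Set (HeightOneSpectrum (𝓞 K)) := {w | ((p : ℕ) : 𝓞 K) ∉ w.asIdeal ∧
    (¬ V.HasGoodReductionAt w ∨ ¬ (adicCompletionPrime K w).inertia (absoluteGaloisGroup K) ≤ (N₁ : Subgroup _))} with hS'
  have hS'fin : S'.Finite := Coinv.finite_exceptional V p N₁
  -- (3) local lifts at every `w ∤ p` and at `𝔮`
  have hz : ∀ w : HeightOneSpectrum (𝓞 K), (((p : ℕ) : 𝓞 K) ∉ w.asIdeal ∨ w = 𝔮) →
      ∃ z : subgroupH1 (decomp (K := K) w) M, ResKernel.resSubgroup (Coinv.kerD κ w) M z = Coinv.resKerD κ M w c :=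
    fun w hw ↦ exists_resSubgroup_kerD_eq_of_forall hstab' htor w hw hSel
  choose z hz using hz
  have hzero : ∀ (w : HeightOneSpectrum (𝓞 K)), ((p : ℕ) : 𝓞 K) ∉ w.asIdeal → w ∉ S' → Coinv.resKerD κ M w c = 0 := by
    intro w hpw hwS
    have hgood : V.HasGoodReductionAt w := by by_contra h; exact hwS ⟨hpw, Or.inl h⟩
    have hI : (adicCompletionPrime K w).inertia (absoluteGaloisGroup K) ≤ (N₁ : Subgroup _) := by
      by_contra h; exact hwS ⟨hpw, Or.inr h⟩
    rw [← hφ] at hSel ⊢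
    exact resKerD_eq_zero_of_good V p π r κ 𝔮 e he₁ he hpw hgood φ hN₁ hI hSel
  -- the finite set `S = Σ' ∪ {𝔮}` and the family
  set S : Finset (HeightOneSpectrum (𝓞 K)) := insert 𝔮 hS'fin.toFinset with hSdef
  have hSp : ∀ w ∈ S, ((p : ℕ) : 𝓞 K) ∉ w.asIdeal ∨ w = 𝔮 := by
    intro w hw
    rcases Finset.mem_insert.mp hw with rfl | hw'
    · exact Or.inr rfl
    · exact Or.inl ((Set.Finite.mem_toFinset _).mp hw').1
  let τ : (w : HeightOneSpectrum (𝓞 K)) → subgroupH1 (decomp (K := K) w) M :=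
    fun w ↦ if h : (((p : ℕ) : 𝓞 K) ∉ w.asIdeal ∨ w = 𝔮) then z w h else 0
  -- (4) = (LS): the global class
  obtain ⟨g, hgS, hg0⟩ := hLS S hSp τ
  refine ⟨resH1Hom (Literature.NumberTheory.EllipticCurves.subgroupIncl (⊤ : Subgroup (absoluteGaloisGroup K))) (AddMonoidHom.id M)
    (fun _ _ ↦ rfl) g, ?_⟩
  have hres : resOfLe M (le_top : κ.kerSubgroup ≤ ⊤)
      (resH1Hom (Literature.NumberTheory.EllipticCurves.subgroupIncl (⊤ : Subgroup (absoluteGaloisGroup K))) (AddMonoidHom.id M)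
        (fun _ _ ↦ rfl) g) = ResKernel.resSubgroup κ.kerSubgroup M g :=
    congrArg (fun f ↦ f g) (Summit.BirchSwinnertonDyer.Rank1Residual.X11b.AcSelmer.resOfLe_top_comp_resH1Hom_subgroupIncl
      (H := κ.kerSubgroup) (M := M))
  rw [hres]
  -- (5) the corrected class is Selmer
  set y := c - ResKernel.resSubgroup κ.kerSubgroup M g with hy
  have hconj : ∀ σ : absoluteGaloisGroup K, conjH1 κ.kerSubgroup M σ y = y + (conjH1 κ.kerSubgroup M σ c - c) := by
    intro σ
    rw [hy, map_sub, Coinv.conjH1_resSubgroup]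
    abel
  have haway : ∀ (w : HeightOneSpectrum (𝓞 K)), (((p : ℕ) : 𝓞 K) ∉ w.asIdeal ∨ w = 𝔮) → y ∈ awayKer κ.kerSubgroup M w := by
    intro w hw
    rw [Coinv.mem_awayKer_iff_resKerD_eq_zero, hy, map_sub, Coinv.resKerD_resSubgroup]
    by_cases hwS : w ∈ S
    · rw [hgS w hwS]
      change Coinv.resKerD κ M w c - ResKernel.resSubgroup (Coinv.kerD κ w) M (if h : _ then z w h else 0) = 0
      rw [dif_pos hw, hz, sub_self]
    · have hne : w ≠ 𝔮 := fun h ↦ hwS (h ▸ Finset.mem_insert_self _ _)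
      have hpw : ((p : ℕ) : 𝓞 K) ∉ w.asIdeal := hw.resolve_right hne
      have hwS' : w ∉ S' := fun h ↦ hwS (Finset.mem_insert_of_mem ((Set.Finite.mem_toFinset _).mpr h))
      rw [hg0 w hwS hpw, map_zero, sub_zero]
      exact hzero w hpw hwS'
  change y ∈ Summit.BirchSwinnertonDyer.Rank1Residual.X11b.AcSelmer.selmerOver κ.kerSubgroup M p 𝔮 ∅
  rw [Summit.BirchSwinnertonDyer.Rank1Residual.X11b.AcSelmer.mem_selmerOver_iff_awayKer]
  refine ⟨fun w hpw _ σ ↦ ?_, fun w σ ↦ ?_, fun σ ↦ ?_⟩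
  · rw [hconj]
    exact add_mem (haway w (Or.inl hpw)) ((Coinv.mem_awayKer_iff_resKerD_eq_zero κ w _).2
      (resKerD_eq_zero_of_mem_restrictedSelmerZp (Or.inl hpw) (hSel σ)))
  · exact Coinv.mem_infKer_of_decompInf_eq_bot w
      (Summit.BirchSwinnertonDyer.Rank1Residual.X11b.AcSelmer.decompInf_eq_bot_of_isComplex (IsTotallyComplex.isComplex w)) _
  · rw [hconj]
    exact add_mem (haway 𝔮 (Or.inr rfl)) ((Coinv.mem_awayKer_iff_resKerD_eq_zero κ 𝔮 _).2
      (resKerD_eq_zero_of_mem_restrictedSelmerZp (Or.inr rfl) (hSel σ)))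

end Summand

/-! ## §3. Road α: (β) and (R-TOP) of p664178 on every S3c frame from (LS) -/

section Frame

variable {K : Type} [Field K] [NumberField K]

/-- **(R-TOP) of `restrictedControl_two_of_residuals` (p664178) ⟸ (LS)**, on every S3c frame carrying a finitely generated dual datum with
`HasCharValuationAt n`: `#𝔖_Γ = 1`, GRANTED (LS) for `W* = E[𝔮_r^∞]` with strict place `v̄` (the level-`K` local surjectivity, dual obstruction
`H¹_{str v}(K, T_v W)`), the conjugate bottom finiteness hfinB' (`𝔖_v(K, W*')` finite — S3b′ at the conjugate frame), `[W.IsGloballyMinimal]`, and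
the cited facts `poitouTate_sha_tateDual K`, `fieldCdLE_two_of_numberField`. (= file 2's `natCard_endCoinvariants_eq_one_of_frame_of_baseLift` with
(β) DISCHARGED from (LS) by `baseLift_of_locSurj`, the projector being -w7 g2's `exists_eigenProjector_two`.)
[cite: Agboola2007, §5 Prop. 5.1] [cite: JetchevSkinnerWan2017, Lemma 3.3.3 and Prop. 3.3.2] [cite: GreenbergLNM1716, §4 Props. 4.13–4.15] -/
theorem natCard_endCoinvariants_eq_one_of_frame_of_locSurj {d : ℤ} (hd0 : d ≠ 0) (W : WeierstrassCurve ℚ) [W.IsElliptic]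
    [W.IsGloballyMinimal] (C : VariableChange ℚ) (hC : C • W = cm7.quadraticTwist (d : ℚ)) (hK : IsImaginaryQuadratic K)
    (v vbar : HeightOneSpectrum (𝓞 K)) (hvbar : ((2 : ℕ) : 𝓞 K) ∈ vbar.asIdeal)
    (π : (W.baseChange K).endRing) (hrel : (π : AddMonoid.End (W.baseChange K).geomPoints) * π = π - 2) {r : ℤ_[2]} (hr : r * r = r - 2)
    (κ' : ZpExtension K 2) (hκ' : κ'.IsUnramifiedOutside vbar) {γ' : absoluteGaloisGroup K} (hγ' : κ'.IsTopGenerator γ')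
    (D : RestrictedDualData κ' ↥((W.baseChange K).endEigenPrimaryTorsion 2 π r) vbar γ') {n : ℕ}
    (hDf : Module.Finite (IwasawaAlgebra 2) D.X) (hDn : D.HasCharValuationAt n)
    (hPT : poitouTate_sha_tateDual K) (hcd : fieldCdLE_two_of_numberField)
    (hfin' : Finite (restrictedSelmerBase ↥((W.baseChange K).endEigenPrimaryTorsion 2 π (1 - r)) 2 v))
    (hLS : ∀ (S : Finset (HeightOneSpectrum (𝓞 K))), (∀ w ∈ S, ((2 : ℕ) : 𝓞 K) ∉ w.asIdeal ∨ w = vbar) →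
      ∀ τ : (w : HeightOneSpectrum (𝓞 K)) → subgroupH1 (decomp (K := K) w) ↥((W.baseChange K).endEigenPrimaryTorsion 2 π r),
      ∃ g : discreteH1 (absoluteGaloisGroup K) ↥((W.baseChange K).endEigenPrimaryTorsion 2 π r),
        (∀ w ∈ S, ResKernel.resSubgroup (decomp (K := K) w) ↥((W.baseChange K).endEigenPrimaryTorsion 2 π r) g = τ w) ∧
        (∀ w : HeightOneSpectrum (𝓞 K), w ∉ S → ((2 : ℕ) : 𝓞 K) ∉ w.asIdeal →
          ResKernel.resSubgroup (decomp (K := K) w) ↥((W.baseChange K).endEigenPrimaryTorsion 2 π r) g = 0)) :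
    Nat.card (EndCoinvariants
      (conjRestricted κ' ↥((W.baseChange K).endEigenPrimaryTorsion 2 π r) vbar γ' - 1)) = 1 := by
  haveI : Fact (Nat.Prime 2) := ⟨Nat.prime_two⟩
  haveI : (W.baseChange K).IsElliptic := by rw [baseChange]; infer_instance
  haveI : IsTotallyComplex K := hK.2
  have hj : W.j = -3375 := j_eq_of_smul_eq_cm7Twist hd0 W C hC
  obtain ⟨θ, hθ⟩ := exists_sq_eq_neg_seven_of_cmEndo_mem_endRing W K hj π hrel
  obtain ⟨e, he₁, -, -, he⟩ := exists_eigenProjector_two W hj K hθ π hrel hr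
  exact natCard_endCoinvariants_eq_one_of_frame_of_baseLift hd0 W C hC hK v vbar hvbar π hrel hr κ' hκ' hγ' D hDf hDn hPT hcd hfin'
    (baseLift_of_locSurj (W.baseChange K) 2 π r κ' vbar hvbar e he₁ he hγ' hLS)

end Frame

end Summit.BirchSwinnertonDyer.BirchSwinnertonDyer.Theorems.PrintCf2.RestrictedSelmerPair

end
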